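import Literature.MathematicalPhysics.QuantumManyBody.GroundStateFeynmanKacDisplacement
import Literature.MathematicalPhysics.QuantumManyBody.GroundStateFeynmanKacHeatKernel
import Mathlib.Topology.UniformSpace.HeineCantor
import HarnessLib

/-!
# Ground state of the Feynman–Kac semigroup, X: the interaction term at small times

Support file for the energy identification in the proof of `GroundStateFeynmanKac`
(Chung–Zhao (1995), Thm 3.17 with §8.3).  For `h ∈ C_c((ℝ³)^N)` and a bounded measurable
pair potential, the interaction part of `t⁻¹⟨h, (P_t − T_t) h⟩` converges to the potential
energy:

  `t⁻¹ ∫ |h(x)| E_x[(∫₀ᵗ V(B_s) ds) |h(B_t)|] dx ⟶ ∫ V |h|²`  as `t → 0+`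

(`tendsto_interactionTerm_div`), with `V = interaction v`, `B_s = worldLine x ω s`.  The proof is
Tonelli, the translation invariance of Lebesgue measure, the `L¹`-continuity of translations of
`h` (uniform continuity, `lintegral_enorm_translate_sub_le_of_norm_lt`), and Markov's inequality
with `E‖c_t‖ = O(√t)` (`lintegral_norm_displacement_le`, from
`GroundStateFeynmanKacDisplacement.lean`); here `c_t = displacement t ω = √2 b_t`.

## References

* K. L. Chung, Z. Zhao, *From Brownian Motion to Schrödinger's Equation*, Springer (1995),
  §3.2–3.3 (Thm 3.10, (3.33)–(3.35)). [cite: ChungZhao1995, §3.3]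
-/

noncomputable section

namespace Literature.MathematicalPhysics.QuantumManyBody.BoseGas

open MeasureTheory ProbabilityTheory Filter Set
open scoped ENNReal NNReal Topology
open Literature.Probability.Process

variable {N : ℕ}

/-! ### The first moment of the displacement in `ℝ≥0∞` -/

/-- `‖√2 b_s‖` is integrable. [folklore] -/
theorem integrable_norm_displacement (s : ℝ≥0) :
    Integrable (fun ω : PathSpace N => ‖displacement s ω‖) (wienerPaths N) := by
  refine ((integrable_sum_runSup (N := N) s).const_mul (Real.sqrt 2)).mono'
    (measurable_displacement s).norm.aestronglyMeasurable (Eventually.of_forall fun ω => ?_)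
  rw [norm_norm]
  exact norm_displacement_le_sum_runSup le_rfl ω

/-- **`E‖√2 b_s‖ ≤ √2 · 3N · 2√t` for `s ≤ t`, in `ℝ≥0∞`** (`integral_norm_displacement_le` read in
`[0, ∞]`, the form consumed by Markov's inequality). [folklore] -/
theorem lintegral_norm_displacement_le {s t : ℝ≥0} (hs : s ≤ t) :
    ∫⁻ ω, ‖displacement s ω‖ₑ ∂wienerPaths N ≤
      ENNReal.ofReal (Real.sqrt 2 * ((3 * N : ℕ) * (2 * Real.sqrt t))) := by
  have h : ∫⁻ ω, ‖displacement s ω‖ₑ ∂wienerPaths N =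
      ENNReal.ofReal (∫ ω, ‖displacement s ω‖ ∂wienerPaths N) := by
    rw [ofReal_integral_eq_lintegral_ofReal (integrable_norm_displacement s)
      (Eventually.of_forall fun ω => norm_nonneg _)]
    exact lintegral_congr fun ω => (ofReal_norm _).symm
  rw [h]
  exact ENNReal.ofReal_le_ofReal (integral_norm_displacement_le hs)

/-! ### `L¹`-continuity of translations for `h ∈ C_c` -/

section Translate

variable {h : Config N → ℝ}

/-- Off the support of both translates the difference vanishes. [folklore] -/
theorem translate_sub_eq_zero {d y : Config N} (hy : y ∉ tsupport h) (hyd : y + d ∉ tsupport h) :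
    h (y + d) - h y = 0 := by
  rw [image_eq_zero_of_notMem_tsupport hy, image_eq_zero_of_notMem_tsupport hyd, sub_zero]

/-- **`L¹`-continuity of translations**: for `h ∈ C_c` and `ε > 0` there is `δ > 0` with
`∫ |h(y + d) − h(y)| dy ≤ ε · 2 vol(tsupport h)` whenever `‖d‖ < δ`. [folklore] -/
theorem lintegral_enorm_translate_sub_le_of_norm_lt (hc : Continuous h) (hs : HasCompactSupport h)
    {ε : ℝ} (hε : 0 < ε) :
    ∃ δ > 0, ∀ d : Config N, ‖d‖ < δ →
      ∫⁻ y, ‖h (y + d) - h y‖ₑ ≤ ENNReal.ofReal ε * (2 * volume (tsupport h)) := by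
  have huc : UniformContinuous h := hs.uniformContinuous_of_continuous hc
  obtain ⟨δ, hδ, hδε⟩ := Metric.uniformContinuous_iff.1 huc ε hε
  refine ⟨δ, hδ, fun d hd => ?_⟩
  set K := tsupport h with hK
  have hKm : MeasurableSet K := hs.isClosed.measurableSet
  set S : Set (Config N) := K ∪ (fun y => y + d) ⁻¹' K with hS
  have hSm : MeasurableSet S := hKm.union (hKm.preimage (measurable_add_const d))
  have hpt : ∀ y, ‖h (y + d) - h y‖ₑ ≤ S.indicator (fun _ => ENNReal.ofReal ε) y := by
    intro y
    by_cases hy : y ∈ S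
    · rw [indicator_of_mem hy, ← ofReal_norm]
      refine ENNReal.ofReal_le_ofReal ?_
      have h1 : dist (y + d) y < δ := by simpa [dist_eq_norm] using hd
      have h2 := hδε h1
      rw [Real.dist_eq] at h2
      rw [Real.norm_eq_abs]
      exact h2.le
    · have hy1 : y ∉ K := fun h' => hy (Or.inl h')
      have hy2 : y + d ∉ K := fun h' => hy (Or.inr h')
      rw [indicator_of_notMem hy, translate_sub_eq_zero hy1 hy2]
      simp
  calc ∫⁻ y, ‖h (y + d) - h y‖ₑ ≤ ∫⁻ y, S.indicator (fun _ => ENNReal.ofReal ε) y := lintegral_mono hpt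
    _ = ENNReal.ofReal ε * volume S := by rw [lintegral_indicator hSm, setLIntegral_const]
    _ ≤ ENNReal.ofReal ε * (2 * volume (tsupport h)) := by
        gcongr
        calc volume S ≤ volume K + volume ((fun y => y + d) ⁻¹' K) := measure_union_le _ _
          _ = volume K + volume K := by rw [measure_preimage_add_right]
          _ = 2 * volume K := (two_mul _).symm

/-- The crude bound `∫ |h(y + d) − h(y)| dy ≤ 2 ∫ |h|`. [folklore] -/
theorem lintegral_enorm_translate_sub_le (hm : Measurable h) (d : Config N) :
    ∫⁻ y, ‖h (y + d) - h y‖ₑ ≤ 2 * ∫⁻ y, ‖h y‖ₑ := by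
  calc ∫⁻ y, ‖h (y + d) - h y‖ₑ ≤ ∫⁻ y, (‖h (y + d)‖ₑ + ‖h y‖ₑ) := lintegral_mono fun y => enorm_sub_le
    _ = (∫⁻ y, ‖h (y + d)‖ₑ) + ∫⁻ y, ‖h y‖ₑ :=
        lintegral_add_left (f := fun y => ‖h (y + d)‖ₑ) (hm.comp (measurable_add_const d)).enorm _
    _ = 2 * ∫⁻ y, ‖h y‖ₑ := by
        rw [show ∫⁻ y, ‖h (y + d)‖ₑ = ∫⁻ y, ‖h y‖ₑ from
          lintegral_add_right_eq_self (fun y => ‖h y‖ₑ) d, two_mul]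

/-- **Random translations**: for a measurable random displacement `d` on the Wiener space,
`E ∫ |h(y + d) − h(y)| dy ≤ ε · 2vol(tsupport h) + 2‖h‖₁ · E‖d‖ / δ` (split on `‖d‖ < δ`, Markov).
[folklore] -/
theorem lintegral_lintegral_enorm_translate_sub_le (hc : Continuous h) (hs : HasCompactSupport h)
    {ε : ℝ} (hε : 0 < ε) :
    ∃ δ > 0, ∀ d : PathSpace N → Config N, Measurable d →
      ∫⁻ ω, ∫⁻ y, ‖h (y + d ω) - h y‖ₑ ∂volume ∂wienerPaths N ≤
        ENNReal.ofReal ε * (2 * volume (tsupport h)) +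
          2 * (∫⁻ y, ‖h y‖ₑ) * ((∫⁻ ω, ‖d ω‖ₑ ∂wienerPaths N) / ENNReal.ofReal δ) := by
  obtain ⟨δ, hδ, hδε⟩ := lintegral_enorm_translate_sub_le_of_norm_lt hc hs hε
  refine ⟨δ, hδ, fun d hd => ?_⟩
  have hm : Measurable h := hc.measurable
  set B : Set (PathSpace N) := {ω | ENNReal.ofReal δ ≤ ‖d ω‖ₑ} with hB
  have hBm : MeasurableSet B := measurableSet_le measurable_const hd.enorm
  have hpt : ∀ ω, ∫⁻ y, ‖h (y + d ω) - h y‖ₑ ≤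
      ENNReal.ofReal ε * (2 * volume (tsupport h)) + B.indicator (fun _ => 2 * ∫⁻ y, ‖h y‖ₑ) ω := by
    intro ω
    by_cases hω : ω ∈ B
    · rw [indicator_of_mem hω]
      exact (lintegral_enorm_translate_sub_le hm (d ω)).trans le_add_self
    · rw [indicator_of_notMem hω, add_zero]
      refine hδε (d ω) ?_
      have : ‖d ω‖ₑ < ENNReal.ofReal δ := not_le.1 hω
      rw [← ofReal_norm] at this
      exact (ENNReal.ofReal_lt_ofReal_iff hδ).1 this
  calc ∫⁻ ω, ∫⁻ y, ‖h (y + d ω) - h y‖ₑ ∂volume ∂wienerPaths N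
      ≤ ∫⁻ ω, (ENNReal.ofReal ε * (2 * volume (tsupport h)) +
          B.indicator (fun _ => 2 * ∫⁻ y, ‖h y‖ₑ) ω) ∂wienerPaths N := lintegral_mono hpt
    _ = ENNReal.ofReal ε * (2 * volume (tsupport h)) + (2 * ∫⁻ y, ‖h y‖ₑ) * wienerPaths N B := by
        rw [lintegral_add_left measurable_const, lintegral_const, measure_univ, mul_one,
          lintegral_indicator hBm, setLIntegral_const]
    _ ≤ _ := by
        gcongr
        exact meas_ge_le_lintegral_div hd.enorm.aemeasurable (ENNReal.ofReal_pos.2 hδ).ne'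
          ENNReal.ofReal_ne_top

end Translate

/-! ### The interaction term -/

section Interaction

variable {v : ℝ → ℝ≥0∞} {C : ℝ≥0} {h : Config N → ℝ}

/-- Joint measurability of the world-lines in (starting point, sample, real time). [folklore] -/
theorem measurable_worldLine₃ :
    Measurable fun p : Config N × PathSpace N × ℝ => worldLine p.1 p.2.1 p.2.2.toNNReal := by
  have h : (fun p : Config N × PathSpace N × ℝ => worldLine p.1 p.2.1 p.2.2.toNNReal) =
      fun p => p.1 + displacement p.2.2.toNNReal p.2.1 := by
    funext p; rw [worldLine_eq_add_displacement]
  rw [h]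
  exact measurable_fst.add (measurable_displacement_uncurry.comp
    ((measurable_real_toNNReal.comp (measurable_snd.comp measurable_snd)).prodMk
      (measurable_fst.comp measurable_snd)))

/-- The integrand `|h(x)| V(B_s) |h(B_t)|` is jointly measurable in `(x, ω, s)`. [folklore] -/
theorem measurable_interactionIntegrand (hv : Measurable v) (hm : Measurable h) (t : ℝ≥0) :
    Measurable fun p : Config N × PathSpace N × ℝ =>
      ‖h p.1‖ₑ * interaction v (worldLine p.1 p.2.1 p.2.2.toNNReal) *
        ‖h (worldLine p.1 p.2.1 t)‖ₑ := by
  refine ((hm.comp measurable_fst).enorm.mul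
    ((measurable_interaction hv).comp measurable_worldLine₃)).mul (hm.comp ?_).enorm
  have : (fun p : Config N × PathSpace N × ℝ => worldLine p.1 p.2.1 t) =
      (fun p : Config N × PathSpace N × ℝ => worldLine p.1 p.2.1 p.2.2.toNNReal) ∘
        fun p => (p.1, p.2.1, (t : ℝ)) := by
    funext p; simp
  rw [this]
  exact measurable_worldLine₃.comp (measurable_fst.prodMk
    ((measurable_fst.comp measurable_snd).prodMk measurable_const))

/-- **Tonelli for the interaction term**:
`∫ |h(x)| E_x[(∫₀ᵗ V(B_s)ds) |h(B_t)|] dx = ∫₀ᵗ E ∫ |h(x)| V(B_s^x) |h(B_t^x)| dx ds`. [folklore] -/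
theorem interactionTerm_eq_lintegral_Ioc (hv : Measurable v) (hm : Measurable h) (t : ℝ≥0) :
    ∫⁻ x, ‖h x‖ₑ * ∫⁻ ω, pathAction v t x ω * ‖h (worldLine x ω t)‖ₑ ∂wienerPaths N =
      ∫⁻ s in Ioc (0 : ℝ) t, ∫⁻ ω, ∫⁻ x,
        ‖h x‖ₑ * interaction v (worldLine x ω s.toNNReal) * ‖h (worldLine x ω t)‖ₑ
          ∂volume ∂wienerPaths N := by
  have hF := measurable_interactionIntegrand hv hm t
  -- put the constants inside the `s`-integral
  have h1 : ∀ x, ‖h x‖ₑ * ∫⁻ ω, pathAction v t x ω * ‖h (worldLine x ω t)‖ₑ ∂wienerPaths N =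
      ∫⁻ ω, ∫⁻ s in Ioc (0 : ℝ) t, ‖h x‖ₑ * interaction v (worldLine x ω s.toNNReal) *
        ‖h (worldLine x ω t)‖ₑ ∂volume ∂wienerPaths N := by
    intro x
    have hFx : Measurable fun q : PathSpace N × ℝ =>
        ‖h x‖ₑ * interaction v (worldLine x q.1 q.2.toNNReal) * ‖h (worldLine x q.1 t)‖ₑ :=
      hF.comp (measurable_const.prodMk measurable_id)
    rw [← lintegral_const_mul' (‖h x‖ₑ) (fun ω => pathAction v t x ω * ‖h (worldLine x ω t)‖ₑ)
      enorm_ne_top]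
    refine lintegral_congr fun ω => ?_
    unfold pathAction
    rw [← lintegral_mul_const' ‖h (worldLine x ω t)‖ₑ
      (fun s : ℝ => interaction v (worldLine x ω s.toNNReal)) enorm_ne_top,
      ← lintegral_const_mul' ‖h x‖ₑ
      (fun s : ℝ => interaction v (worldLine x ω s.toNNReal) * ‖h (worldLine x ω t)‖ₑ) enorm_ne_top]
    refine lintegral_congr fun s => ?_
    ring
  simp_rw [h1]
  -- swap `x` with `ω`, then `x` with `s`, then `ω` with `s`
  have hG : Measurable fun q : Config N × PathSpace N => ∫⁻ s in Ioc (0 : ℝ) t,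
      ‖h q.1‖ₑ * interaction v (worldLine q.1 q.2 s.toNNReal) * ‖h (worldLine q.1 q.2 t)‖ₑ := by
    have : Measurable fun r : (Config N × PathSpace N) × ℝ =>
        ‖h r.1.1‖ₑ * interaction v (worldLine r.1.1 r.1.2 r.2.toNNReal) *
          ‖h (worldLine r.1.1 r.1.2 t)‖ₑ :=
      hF.comp ((measurable_fst.comp measurable_fst).prodMk
        ((measurable_snd.comp measurable_fst).prodMk measurable_snd))
    exact this.lintegral_prod_right'
  rw [lintegral_lintegral_swap hG.aemeasurable]
  have h2 : ∀ ω : PathSpace N, ∫⁻ x, ∫⁻ s in Ioc (0 : ℝ) t,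
      ‖h x‖ₑ * interaction v (worldLine x ω s.toNNReal) * ‖h (worldLine x ω t)‖ₑ =
      ∫⁻ s in Ioc (0 : ℝ) t, ∫⁻ x,
        ‖h x‖ₑ * interaction v (worldLine x ω s.toNNReal) * ‖h (worldLine x ω t)‖ₑ := by
    intro ω
    exact lintegral_lintegral_swap ((hF.comp (measurable_fst.prodMk
      (measurable_const.prodMk measurable_snd))).aemeasurable)
  simp_rw [h2]
  have hH : Measurable fun q : PathSpace N × ℝ => ∫⁻ x,
      ‖h x‖ₑ * interaction v (worldLine x q.1 q.2.toNNReal) * ‖h (worldLine x q.1 t)‖ₑ := by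
    have : Measurable fun r : (PathSpace N × ℝ) × Config N =>
        ‖h r.2‖ₑ * interaction v (worldLine r.2 r.1.1 r.1.2.toNNReal) *
          ‖h (worldLine r.2 r.1.1 t)‖ₑ :=
      hF.comp (measurable_snd.prodMk measurable_fst)
    exact this.lintegral_prod_right'
  rw [lintegral_lintegral_swap hH.aemeasurable]

/-- Translation of the `x`-integral: `∫ |h(x)| V(x + c_s) |h(x + c_t)| dx =
∫ |h(y − c_s)| V(y) |h(y − c_s + c_t)| dy`. [folklore] -/
theorem lintegral_interactionIntegrand_translate (ω : PathSpace N) (s t : ℝ≥0) :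
    ∫⁻ x, ‖h x‖ₑ * interaction v (worldLine x ω s) * ‖h (worldLine x ω t)‖ₑ =
      ∫⁻ y, ‖h (y - displacement s ω)‖ₑ * interaction v y *
        ‖h (y - displacement s ω + displacement t ω)‖ₑ := by
  rw [← lintegral_add_right_eq_self (μ := (volume : Measure (Config N)))
    (fun y => ‖h (y - displacement s ω)‖ₑ * interaction v y *
      ‖h (y - displacement s ω + displacement t ω)‖ₑ)
    (displacement s ω)]
  refine lintegral_congr fun x => ?_
  simp only [add_sub_cancel_right]
  rw [← worldLine_eq_add_displacement, ← worldLine_eq_add_displacement]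

/-- Pointwise comparison, upper: for `a, b, a₀ ≤ M`, `a ≤ a₀ + da`, `b ≤ a₀ + db`:
`a b ≤ a₀² + M (da + db)`. [folklore] -/
theorem mul_le_sq_add {a b a₀ M da db : ℝ≥0∞} (ha : a ≤ M) (ha₀ : a₀ ≤ M)
    (hda : a ≤ a₀ + da) (hdb : b ≤ a₀ + db) :
    a * b ≤ a₀ * a₀ + M * (da + db) := by
  calc a * b ≤ a * (a₀ + db) := by gcongr
    _ = a * a₀ + a * db := mul_add _ _ _
    _ ≤ (a₀ + da) * a₀ + M * db := by gcongr
    _ = a₀ * a₀ + da * a₀ + M * db := by ring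
    _ ≤ a₀ * a₀ + da * M + M * db := by gcongr
    _ = a₀ * a₀ + M * (da + db) := by ring

/-- Pointwise comparison, lower: for `a, a₀ ≤ M`, `a₀ ≤ a + da`, `a₀ ≤ b + db`:
`a₀² ≤ a b + M (da + db)`. [folklore] -/
theorem sq_le_mul_add {a b a₀ M da db : ℝ≥0∞} (ha : a ≤ M) (ha₀ : a₀ ≤ M)
    (hda : a₀ ≤ a + da) (hdb : a₀ ≤ b + db) :
    a₀ * a₀ ≤ a * b + M * (da + db) := by
  calc a₀ * a₀ ≤ (a + da) * a₀ := by gcongr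
    _ = a * a₀ + da * a₀ := add_mul _ _ _
    _ ≤ a * (b + db) + da * M := by gcongr
    _ = a * b + a * db + da * M := by ring
    _ ≤ a * b + M * db + da * M := by gcongr
    _ = a * b + M * (da + db) := by ring

/-- **Deterministic slice comparison**: for displacements `c₁, c₂` and `M = sup |h|`,
`∫ |h(y − c₁)| V(y) |h(y − c₁ + c₂)| dy` differs from `I = ∫ V |h|²` by at most
`(N²C) M (∫ |h(y − c₁) − h(y)| dy + ∫ |h(y + (c₂ − c₁)) − h(y)| dy)` (both directions, stated
additively in `ℝ≥0∞`). [folklore] -/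
theorem lintegral_slice_le (hv : Measurable v) (hC : ∀ r, v r ≤ C) (hm : Measurable h) {M : ℝ}
    (hM : ∀ x, ‖h x‖ ≤ M) (c₁ c₂ : Config N) :
    (∫⁻ y, ‖h (y + -c₁)‖ₑ * interaction v y * ‖h (y + -c₁ + c₂)‖ₑ ≤
      (∫⁻ y, interaction v y * ‖h y‖ₑ ^ 2) + ((N * N : ℕ) * C * ENNReal.ofReal M) *
        ((∫⁻ y, ‖h (y + -c₁) - h y‖ₑ) + ∫⁻ y, ‖h (y + (c₂ - c₁)) - h y‖ₑ)) ∧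
    ((∫⁻ y, interaction v y * ‖h y‖ₑ ^ 2) ≤
      (∫⁻ y, ‖h (y + -c₁)‖ₑ * interaction v y * ‖h (y + -c₁ + c₂)‖ₑ) +
        ((N * N : ℕ) * C * ENNReal.ofReal M) *
          ((∫⁻ y, ‖h (y + -c₁) - h y‖ₑ) + ∫⁻ y, ‖h (y + (c₂ - c₁)) - h y‖ₑ)) := by
  have hVm_top : ((N * N : ℕ) * C : ℝ≥0∞) ≠ ⊤ :=
    ENNReal.mul_ne_top (ENNReal.natCast_ne_top _) ENNReal.coe_ne_top
  have hV : ∀ x : Config N, interaction v x ≤ (N * N : ℕ) * C := fun x => interaction_le_of_le hC x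
  have hMe : ∀ x, ‖h x‖ₑ ≤ ENNReal.ofReal M := fun x => by
    rw [← ofReal_norm]; exact ENNReal.ofReal_le_ofReal (hM x)
  have tri : ∀ p q : ℝ, ‖p‖ₑ ≤ ‖q‖ₑ + ‖p - q‖ₑ := fun p q => by
    calc ‖p‖ₑ = ‖q + (p - q)‖ₑ := by rw [add_sub_cancel]
      _ ≤ ‖q‖ₑ + ‖p - q‖ₑ := enorm_add_le _ _
  have tri' : ∀ p q : ℝ, ‖q‖ₑ ≤ ‖p‖ₑ + ‖p - q‖ₑ := fun p q => by
    calc ‖q‖ₑ = ‖p - (p - q)‖ₑ := by rw [sub_sub_cancel]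
      _ ≤ ‖p‖ₑ + ‖p - q‖ₑ := enorm_sub_le
  have hassoc : ∀ y : Config N, y + -c₁ + c₂ = y + (c₂ - c₁) := fun y => by abel
  have hDa : Measurable fun y : Config N => ‖h (y + -c₁) - h y‖ₑ :=
    ((hm.comp (measurable_add_const _)).sub hm).enorm
  have hF : Measurable fun y : Config N => ‖h (y + -c₁)‖ₑ * interaction v y * ‖h (y + -c₁ + c₂)‖ₑ :=
    ((hm.comp (measurable_add_const _)).enorm.mul (measurable_interaction hv)).mul
      (hm.comp ((measurable_add_const _).add_const _)).enorm
  have hI0 : Measurable fun y : Config N => interaction v y * ‖h y‖ₑ ^ 2 :=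
    (measurable_interaction hv).mul (hm.enorm.pow_const 2)
  have herr : ∫⁻ y, ENNReal.ofReal M * (‖h (y + -c₁) - h y‖ₑ + ‖h (y + (c₂ - c₁)) - h y‖ₑ) =
      ENNReal.ofReal M * ((∫⁻ y, ‖h (y + -c₁) - h y‖ₑ) + ∫⁻ y, ‖h (y + (c₂ - c₁)) - h y‖ₑ) := by
    rw [lintegral_const_mul' _ _ ENNReal.ofReal_ne_top, lintegral_add_left hDa]
  constructor
  · calc ∫⁻ y, ‖h (y + -c₁)‖ₑ * interaction v y * ‖h (y + -c₁ + c₂)‖ₑ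
        ≤ ∫⁻ y, (interaction v y * ‖h y‖ₑ ^ 2 + (N * N : ℕ) * C * (ENNReal.ofReal M *
            (‖h (y + -c₁) - h y‖ₑ + ‖h (y + (c₂ - c₁)) - h y‖ₑ))) := by
          refine lintegral_mono fun y => ?_
          have hab := mul_le_sq_add (b := ‖h (y + -c₁ + c₂)‖ₑ) (hMe (y + -c₁)) (hMe y)
            (tri _ _) (by rw [hassoc]; exact tri _ _)
          calc ‖h (y + -c₁)‖ₑ * interaction v y * ‖h (y + -c₁ + c₂)‖ₑ
              = interaction v y * (‖h (y + -c₁)‖ₑ * ‖h (y + -c₁ + c₂)‖ₑ) := by ring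
            _ ≤ interaction v y * (‖h y‖ₑ * ‖h y‖ₑ + ENNReal.ofReal M *
                  (‖h (y + -c₁) - h y‖ₑ + ‖h (y + (c₂ - c₁)) - h y‖ₑ)) := by gcongr
            _ = interaction v y * ‖h y‖ₑ ^ 2 + interaction v y * (ENNReal.ofReal M *
                  (‖h (y + -c₁) - h y‖ₑ + ‖h (y + (c₂ - c₁)) - h y‖ₑ)) := by rw [mul_add, sq]
            _ ≤ _ := by gcongr; exact hV y
      _ = _ := by
          rw [lintegral_add_left hI0, lintegral_const_mul' _ _ hVm_top, herr]
          ring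
  · calc ∫⁻ y, interaction v y * ‖h y‖ₑ ^ 2
        ≤ ∫⁻ y, (‖h (y + -c₁)‖ₑ * interaction v y * ‖h (y + -c₁ + c₂)‖ₑ +
            (N * N : ℕ) * C * (ENNReal.ofReal M *
              (‖h (y + -c₁) - h y‖ₑ + ‖h (y + (c₂ - c₁)) - h y‖ₑ))) := by
          refine lintegral_mono fun y => ?_
          have hab := sq_le_mul_add (b := ‖h (y + -c₁ + c₂)‖ₑ) (hMe (y + -c₁)) (hMe y)
            (tri' _ _) (by rw [hassoc]; exact tri' _ _)
          calc interaction v y * ‖h y‖ₑ ^ 2 = interaction v y * (‖h y‖ₑ * ‖h y‖ₑ) := by rw [sq]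
            _ ≤ interaction v y * (‖h (y + -c₁)‖ₑ * ‖h (y + -c₁ + c₂)‖ₑ +
                  ENNReal.ofReal M * (‖h (y + -c₁) - h y‖ₑ + ‖h (y + (c₂ - c₁)) - h y‖ₑ)) := by
                gcongr
            _ = ‖h (y + -c₁)‖ₑ * interaction v y * ‖h (y + -c₁ + c₂)‖ₑ +
                  interaction v y * (ENNReal.ofReal M *
                    (‖h (y + -c₁) - h y‖ₑ + ‖h (y + (c₂ - c₁)) - h y‖ₑ)) := by ring
            _ ≤ _ := by gcongr; exact hV y
      _ = _ := by
          rw [lintegral_add_left hF, lintegral_const_mul' _ _ hVm_top, herr]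
          ring

/-- **The translated slice against `∫ V|h|²`** (the deterministic comparison integrated over the
Wiener measure): with the `L¹`-translation errors of the random displacements `d₁ = −c_s`,
`d₂ = c_t − c_s`, the slice `Φ(s,t) = E ∫ |h(x)| V(x + c_s) |h(x + c_t)| dx` satisfies
`Φ ≤ I + A (T d₁ + T d₂)` and `I ≤ Φ + A (T d₁ + T d₂)`. [folklore] -/
theorem interactionSlice_le (hv : Measurable v) (hC : ∀ r, v r ≤ C) (hm : Measurable h) {M : ℝ}
    (hM : ∀ x, ‖h x‖ ≤ M) (s t : ℝ≥0) :
    (∫⁻ ω, ∫⁻ x, ‖h x‖ₑ * interaction v (worldLine x ω s) * ‖h (worldLine x ω t)‖ₑ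
        ∂volume ∂wienerPaths N ≤
      (∫⁻ x, interaction v x * ‖h x‖ₑ ^ 2) + ((N * N : ℕ) * C * ENNReal.ofReal M) *
        ((∫⁻ ω, ∫⁻ y, ‖h (y + -displacement s ω) - h y‖ₑ ∂volume ∂wienerPaths N) +
          ∫⁻ ω, ∫⁻ y, ‖h (y + (displacement t ω - displacement s ω)) - h y‖ₑ
            ∂volume ∂wienerPaths N)) ∧
    ((∫⁻ x, interaction v x * ‖h x‖ₑ ^ 2) ≤
      (∫⁻ ω, ∫⁻ x, ‖h x‖ₑ * interaction v (worldLine x ω s) * ‖h (worldLine x ω t)‖ₑ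
        ∂volume ∂wienerPaths N) + ((N * N : ℕ) * C * ENNReal.ofReal M) *
        ((∫⁻ ω, ∫⁻ y, ‖h (y + -displacement s ω) - h y‖ₑ ∂volume ∂wienerPaths N) +
          ∫⁻ ω, ∫⁻ y, ‖h (y + (displacement t ω - displacement s ω)) - h y‖ₑ
            ∂volume ∂wienerPaths N)) := by
  have hA_top : ((N * N : ℕ) * C * ENNReal.ofReal M : ℝ≥0∞) ≠ ⊤ :=
    ENNReal.mul_ne_top (ENNReal.mul_ne_top (ENNReal.natCast_ne_top _) ENNReal.coe_ne_top)
      ENNReal.ofReal_ne_top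
  -- translate the slice and normalise `y - c = y + -c`
  have htr : ∀ ω, ∫⁻ x, ‖h x‖ₑ * interaction v (worldLine x ω s) * ‖h (worldLine x ω t)‖ₑ =
      ∫⁻ y, ‖h (y + -displacement s ω)‖ₑ * interaction v y *
        ‖h (y + -displacement s ω + displacement t ω)‖ₑ := fun ω => by
    rw [lintegral_interactionIntegrand_translate ω s t]
    simp_rw [sub_eq_add_neg]
  simp_rw [htr]
  -- measurability of the two error integrands in `(ω, y)`
  have hDa : Measurable fun q : PathSpace N × Config N =>
      ‖h (q.2 + -displacement s q.1) - h q.2‖ₑ :=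
    ((hm.comp (measurable_snd.add ((measurable_displacement s).comp measurable_fst).neg)).sub
      (hm.comp measurable_snd)).enorm
  have hDb : Measurable fun q : PathSpace N × Config N =>
      ‖h (q.2 + (displacement t q.1 - displacement s q.1)) - h q.2‖ₑ :=
    ((hm.comp (measurable_snd.add (((measurable_displacement t).comp measurable_fst).sub
      ((measurable_displacement s).comp measurable_fst)))).sub (hm.comp measurable_snd)).enorm
  have hsplit : ∫⁻ ω, ((∫⁻ y, ‖h (y + -displacement s ω) - h y‖ₑ) +
      ∫⁻ y, ‖h (y + (displacement t ω - displacement s ω)) - h y‖ₑ)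
        ∂wienerPaths N =
      (∫⁻ ω, ∫⁻ y, ‖h (y + -displacement s ω) - h y‖ₑ ∂volume ∂wienerPaths N) +
        ∫⁻ ω, ∫⁻ y, ‖h (y + (displacement t ω - displacement s ω)) - h y‖ₑ
          ∂volume ∂wienerPaths N :=
    lintegral_add_left hDa.lintegral_prod_right' _
  constructor
  · calc ∫⁻ ω, ∫⁻ y, ‖h (y + -displacement s ω)‖ₑ * interaction v y *
          ‖h (y + -displacement s ω + displacement t ω)‖ₑ
            ∂volume ∂wienerPaths N
        ≤ ∫⁻ ω, ((∫⁻ x, interaction v x * ‖h x‖ₑ ^ 2) + ((N * N : ℕ) * C * ENNReal.ofReal M) *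
            ((∫⁻ y, ‖h (y + -displacement s ω) - h y‖ₑ) +
              ∫⁻ y, ‖h (y + (displacement t ω - displacement s ω)) - h y‖ₑ))
            ∂wienerPaths N :=
          lintegral_mono fun ω => (lintegral_slice_le hv hC hm hM _ _).1
      _ = _ := by
          rw [lintegral_add_left measurable_const, lintegral_const, measure_univ, mul_one,
            lintegral_const_mul' _ _ hA_top, hsplit]
  · calc ∫⁻ x, interaction v x * ‖h x‖ₑ ^ 2
        = ∫⁻ _ω, (∫⁻ x, interaction v x * ‖h x‖ₑ ^ 2) ∂wienerPaths N := by
          rw [lintegral_const, measure_univ, mul_one]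
      _ ≤ ∫⁻ ω, ((∫⁻ y, ‖h (y + -displacement s ω)‖ₑ * interaction v y *
            ‖h (y + -displacement s ω + displacement t ω)‖ₑ) +
            ((N * N : ℕ) * C * ENNReal.ofReal M) *
              ((∫⁻ y, ‖h (y + -displacement s ω) - h y‖ₑ) +
                ∫⁻ y, ‖h (y + (displacement t ω - displacement s ω)) - h y‖ₑ))
            ∂wienerPaths N :=
          lintegral_mono fun ω => (lintegral_slice_le hv hC hm hM _ _).2
      _ = _ := by
          rw [lintegral_add_right _ (g := fun ω => ((N * N : ℕ) * C * ENNReal.ofReal M) *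
              ((∫⁻ y, ‖h (y + -displacement s ω) - h y‖ₑ) +
                ∫⁻ y, ‖h (y + (displacement t ω - displacement s ω)) - h y‖ₑ))
            ((hDa.lintegral_prod_right'.add hDb.lintegral_prod_right').const_mul _),
            lintegral_const_mul' _ _ hA_top, hsplit]

/-- **The interaction term at small times** (Chung–Zhao §3.3: the potential part of the
generator on `C_c`): for `h ∈ C_c((ℝ³)^N)` and a bounded measurable pair profile `v`,
`t⁻¹ ∫ |h(x)| E_x[(∫₀ᵗ V(B_s)ds) |h(B_t)|] dx → ∫ V |h|²` as `t → 0+`, `V = interaction v`.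
[cite: ChungZhao1995, §3.3 (3.35)] -/
theorem tendsto_interactionTerm_div (hv : Measurable v) (hC : ∀ r, v r ≤ C) (hc : Continuous h)
    (hs : HasCompactSupport h) :
    Tendsto (fun t : ℝ≥0 =>
      (∫⁻ x, ‖h x‖ₑ * ∫⁻ ω, pathAction v t x ω * ‖h (worldLine x ω t)‖ₑ ∂wienerPaths N) / t)
      (𝓝[>] 0) (𝓝 (∫⁻ x, interaction v x * ‖h x‖ₑ ^ 2)) := by
  have hm : Measurable h := hc.measurable
  obtain ⟨M, hM⟩ := hc.bounded_above_of_compact_support hs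
  have hM0 : 0 ≤ M := le_trans (norm_nonneg _) (hM 0)
  set K := tsupport h with hK
  have hKc : IsCompact K := hs
  have hKfin : volume K < ⊤ := hKc.measure_lt_top
  set Vm : ℝ≥0∞ := (N * N : ℕ) * C with hVm
  have hV : ∀ x : Config N, interaction v x ≤ Vm := fun x => interaction_le_of_le hC x
  have hVm_top : Vm ≠ ⊤ := ENNReal.mul_ne_top (ENNReal.natCast_ne_top _) ENNReal.coe_ne_top
  set I : ℝ≥0∞ := ∫⁻ x, interaction v x * ‖h x‖ₑ ^ 2 with hI
  have hMe : ∀ x, ‖h x‖ₑ ≤ ENNReal.ofReal M := fun x => by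
    rw [← ofReal_norm]; exact ENNReal.ofReal_le_ofReal (hM x)
  have hsuppK : ∀ x, x ∉ K → h x = 0 := fun x hx => image_eq_zero_of_notMem_tsupport hx
  have hL1 : ∫⁻ y, ‖h y‖ₑ ≤ ENNReal.ofReal M * volume K := by
    calc ∫⁻ y, ‖h y‖ₑ ≤ ∫⁻ y, K.indicator (fun _ => ENNReal.ofReal M) y := by
          refine lintegral_mono fun y => ?_
          by_cases hy : y ∈ K
          · rw [indicator_of_mem hy]; exact hMe y
          · rw [indicator_of_notMem hy, hsuppK y hy]; simp
      _ = ENNReal.ofReal M * volume K := by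
          rw [lintegral_indicator hKc.isClosed.measurableSet, setLIntegral_const]
  have hL1_top : ∫⁻ y, ‖h y‖ₑ ≠ ⊤ :=
    ne_top_of_le_ne_top (ENNReal.mul_ne_top ENNReal.ofReal_ne_top hKfin.ne) hL1
  have hI_le : I ≤ Vm * (ENNReal.ofReal M * (ENNReal.ofReal M * volume K)) := by
    calc I ≤ ∫⁻ x, Vm * (ENNReal.ofReal M * K.indicator (fun _ => ENNReal.ofReal M) x) := by
          refine lintegral_mono fun x => ?_
          by_cases hx : x ∈ K
          · rw [indicator_of_mem hx, sq]
            gcongr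
            · exact hV x
            · exact hMe x
            · exact hMe x
          · rw [hsuppK x hx]; simp
      _ = Vm * (ENNReal.ofReal M * (ENNReal.ofReal M * volume K)) := by
          rw [lintegral_const_mul' _ _ hVm_top, lintegral_const_mul' _ _ ENNReal.ofReal_ne_top,
            lintegral_indicator hKc.isClosed.measurableSet, setLIntegral_const]
  have hI_top : I ≠ ⊤ := ne_top_of_le_ne_top (ENNReal.mul_ne_top hVm_top (ENNReal.mul_ne_top
    ENNReal.ofReal_ne_top (ENNReal.mul_ne_top ENNReal.ofReal_ne_top hKfin.ne))) hI_le
  set A : ℝ≥0∞ := Vm * ENNReal.ofReal M with hA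
  have hA_top : A ≠ ⊤ := ENNReal.mul_ne_top hVm_top ENNReal.ofReal_ne_top
  rw [ENNReal.tendsto_nhds hI_top]
  intro ε hε
  rcases eq_or_ne ε ⊤ with rfl | hεtop
  · exact Eventually.of_forall fun t => ⟨by simp, by simp⟩
  have hε2 : 0 < ε / 2 := ENNReal.half_pos hε.ne'
  have hε2top : ε / 2 ≠ ⊤ := ENNReal.div_ne_top hεtop (by norm_num)
  -- choose `ε'` with `A · 2 · (ε' · 2 volK) ≤ ε / 2`
  set B : ℝ≥0∞ := A * (2 * (2 * volume K)) with hB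
  have hB_top : B ≠ ⊤ :=
    ENNReal.mul_ne_top hA_top (ENNReal.mul_ne_top (by norm_num) (ENNReal.mul_ne_top (by norm_num) hKfin.ne))
  set ε' : ℝ := (ε / 2).toReal / (B.toReal + 1) with hε'
  have hε'pos : 0 < ε' := div_pos (ENNReal.toReal_pos hε2.ne' hε2top) (by positivity)
  have hfirst : A * (2 * (ENNReal.ofReal ε' * (2 * volume K))) ≤ ε / 2 := by
    have : A * (2 * (ENNReal.ofReal ε' * (2 * volume K))) = ENNReal.ofReal ε' * B := by
      simp only [hB]; ring
    rw [this, ← ENNReal.ofReal_toReal hB_top, ← ENNReal.ofReal_mul hε'pos.le,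
      ← ENNReal.ofReal_toReal hε2top]
    refine ENNReal.ofReal_le_ofReal ?_
    rw [hε', div_mul_eq_mul_div, div_le_iff₀ (by positivity)]
    nlinarith [ENNReal.toReal_nonneg (a := ε / 2), ENNReal.toReal_nonneg (a := B)]
  obtain ⟨δ, hδ, hT⟩ := lintegral_lintegral_enorm_translate_sub_le (N := N) hc hs hε'pos
  -- the moment bound `m t`
  set m : ℝ≥0 → ℝ≥0∞ := fun t => ENNReal.ofReal (Real.sqrt 2 * ((3 * N : ℕ) * (2 * Real.sqrt t)))
    with hmdef
  have hm0 : Tendsto m (𝓝[>] 0) (𝓝 0) := by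
    have hcont : Continuous fun t : ℝ≥0 =>
        ENNReal.ofReal (Real.sqrt 2 * ((3 * N : ℕ) * (2 * Real.sqrt t))) :=
      ENNReal.continuous_ofReal.comp (continuous_const.mul (continuous_const.mul
        (continuous_const.mul (Real.continuous_sqrt.comp NNReal.continuous_coe))))
    have := hcont.tendsto 0
    simp only [NNReal.coe_zero, Real.sqrt_zero, mul_zero, ENNReal.ofReal_zero] at this
    exact this.mono_left nhdsWithin_le_nhds
  -- the second error term is eventually `≤ ε / 2`
  set δi : ℝ≥0∞ := (ENNReal.ofReal δ)⁻¹ with hδi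
  have hδi_top : δi ≠ ⊤ := ENNReal.inv_ne_top.2 (ENNReal.ofReal_pos.2 hδ).ne'
  set E₂ : ℝ≥0 → ℝ≥0∞ := fun t => A * (2 * (∫⁻ y, ‖h y‖ₑ) * (3 * m t * δi)) with hE₂
  have hE₂0 : Tendsto E₂ (𝓝[>] 0) (𝓝 0) := by
    have : E₂ = fun t => (A * (2 * (∫⁻ y, ‖h y‖ₑ) * (3 * δi))) * m t := by
      funext t; simp only [hE₂]; ring
    rw [this]
    have h0 : (A * (2 * (∫⁻ y, ‖h y‖ₑ) * (3 * δi))) * 0 = 0 := mul_zero _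
    rw [← h0]
    refine ENNReal.Tendsto.const_mul hm0 (Or.inr ?_)
    exact ENNReal.mul_ne_top hA_top (ENNReal.mul_ne_top (ENNReal.mul_ne_top (by norm_num) hL1_top)
      (ENNReal.mul_ne_top (by norm_num) hδi_top))
  have hsecond : ∀ᶠ t in 𝓝[>] (0 : ℝ≥0), E₂ t ≤ ε / 2 :=
    ((tendsto_order.1 hE₂0).2 _ hε2).mono fun t ht => ht.le
  have hpos : ∀ᶠ t in 𝓝[>] (0 : ℝ≥0), 0 < t := eventually_mem_nhdsWithin
  filter_upwards [hsecond, hpos] with t ht2 htpos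
  have ht0 : (t : ℝ≥0∞) ≠ 0 := by exact_mod_cast htpos.ne'
  have httop : (t : ℝ≥0∞) ≠ ⊤ := ENNReal.coe_ne_top
  -- total error at time `t`
  set err : ℝ≥0∞ := A * (2 * (ENNReal.ofReal ε' * (2 * volume K))) + E₂ t with herr
  have herr_le : err ≤ ε := by
    calc err ≤ ε / 2 + ε / 2 := add_le_add hfirst ht2
      _ = ε := ENNReal.add_halves ε
  -- slice bounds for `s ≤ t`
  have hslice : ∀ s : ℝ≥0, s ≤ t →
      (∫⁻ ω, ∫⁻ x, ‖h x‖ₑ * interaction v (worldLine x ω s) * ‖h (worldLine x ω t)‖ₑ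
          ∂volume ∂wienerPaths N ≤ I + err) ∧
      (I ≤ (∫⁻ ω, ∫⁻ x, ‖h x‖ₑ * interaction v (worldLine x ω s) * ‖h (worldLine x ω t)‖ₑ
          ∂volume ∂wienerPaths N) + err) := by
    intro s hst
    have hsl := interactionSlice_le (N := N) hv hC hm hM s t
    -- bound the translation errors
    have hT₁ := hT (fun ω => -displacement s ω) (measurable_displacement s).neg
    have hT₂ := hT (fun ω => displacement t ω - displacement s ω)
      ((measurable_displacement t).sub (measurable_displacement s))
    have hd₁ : ∫⁻ ω, ‖-displacement s ω‖ₑ ∂wienerPaths N ≤ m t := by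
      have hneg : ∀ ω : PathSpace N, ‖-displacement s ω‖ₑ = ‖displacement s ω‖ₑ :=
        fun ω => enorm_neg _
      simp_rw [hneg]
      exact lintegral_norm_displacement_le hst
    have hd₂ : ∫⁻ ω, ‖displacement t ω - displacement s ω‖ₑ ∂wienerPaths N ≤
        2 * m t := by
      calc ∫⁻ ω, ‖displacement t ω - displacement s ω‖ₑ ∂wienerPaths N
          ≤ ∫⁻ ω, (‖displacement t ω‖ₑ + ‖displacement s ω‖ₑ) ∂wienerPaths N :=
            lintegral_mono fun ω => enorm_sub_le
        _ = (∫⁻ ω, ‖displacement t ω‖ₑ ∂wienerPaths N) +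
              ∫⁻ ω, ‖displacement s ω‖ₑ ∂wienerPaths N :=
            lintegral_add_left (measurable_displacement (N := N) t).enorm _
        _ ≤ m t + m t := add_le_add (lintegral_norm_displacement_le le_rfl)
            (lintegral_norm_displacement_le hst)
        _ = 2 * m t := (two_mul _).symm
    have hsum : ((N * N : ℕ) * C * ENNReal.ofReal M) *
        ((∫⁻ ω, ∫⁻ y, ‖h (y + -displacement s ω) - h y‖ₑ ∂volume ∂wienerPaths N) +
          ∫⁻ ω, ∫⁻ y, ‖h (y + (displacement t ω - displacement s ω)) - h y‖ₑ
            ∂volume ∂wienerPaths N) ≤ err := by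
      have hb₁ : (∫⁻ ω, ∫⁻ y, ‖h (y + -displacement s ω) - h y‖ₑ ∂volume ∂wienerPaths N) ≤
          ENNReal.ofReal ε' * (2 * volume K) + 2 * (∫⁻ y, ‖h y‖ₑ) * (m t * δi) := by
        refine hT₁.trans ?_
        rw [div_eq_mul_inv]
        gcongr
      have hb₂ : (∫⁻ ω, ∫⁻ y, ‖h (y + (displacement t ω - displacement s ω)) - h y‖ₑ
          ∂volume ∂wienerPaths N) ≤
          ENNReal.ofReal ε' * (2 * volume K) + 2 * (∫⁻ y, ‖h y‖ₑ) * (2 * m t * δi) := by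
        refine hT₂.trans ?_
        rw [div_eq_mul_inv]
        gcongr
      calc ((N * N : ℕ) * C * ENNReal.ofReal M) *
          ((∫⁻ ω, ∫⁻ y, ‖h (y + -displacement s ω) - h y‖ₑ ∂volume ∂wienerPaths N) +
            ∫⁻ ω, ∫⁻ y, ‖h (y + (displacement t ω - displacement s ω)) - h y‖ₑ
              ∂volume ∂wienerPaths N)
          ≤ A * ((ENNReal.ofReal ε' * (2 * volume K) + 2 * (∫⁻ y, ‖h y‖ₑ) * (m t * δi)) +
              (ENNReal.ofReal ε' * (2 * volume K) + 2 * (∫⁻ y, ‖h y‖ₑ) * (2 * m t * δi))) := by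
            rw [← hA]
            gcongr
        _ = err := by
            simp only [herr, hE₂]
            ring
    exact ⟨hsl.1.trans (add_le_add le_rfl hsum), hsl.2.trans (add_le_add le_rfl hsum)⟩
  -- integrate the slices over `s ∈ (0, t]`
  rw [interactionTerm_eq_lintegral_Ioc hv hm t]
  have hvol : volume (Ioc (0 : ℝ) t) = (t : ℝ≥0∞) := by
    rw [Real.volume_Ioc, sub_zero, ENNReal.ofReal_coe_nnreal]
  have hup : ∫⁻ s in Ioc (0 : ℝ) t, ∫⁻ ω, ∫⁻ x,
      ‖h x‖ₑ * interaction v (worldLine x ω s.toNNReal) * ‖h (worldLine x ω t)‖ₑ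
        ∂volume ∂wienerPaths N ≤ (I + err) * t := by
    calc ∫⁻ s in Ioc (0 : ℝ) t, ∫⁻ ω, ∫⁻ x,
          ‖h x‖ₑ * interaction v (worldLine x ω s.toNNReal) * ‖h (worldLine x ω t)‖ₑ
            ∂volume ∂wienerPaths N
        ≤ ∫⁻ _s in Ioc (0 : ℝ) t, (I + err) := by
          refine setLIntegral_mono' measurableSet_Ioc fun s hs' => ?_
          exact (hslice s.toNNReal (Real.toNNReal_le_iff_le_coe.2 hs'.2)).1
      _ = (I + err) * t := by rw [setLIntegral_const, hvol]
  have hlow : I * t ≤ (∫⁻ s in Ioc (0 : ℝ) t, ∫⁻ ω, ∫⁻ x,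
      ‖h x‖ₑ * interaction v (worldLine x ω s.toNNReal) * ‖h (worldLine x ω t)‖ₑ
        ∂volume ∂wienerPaths N) + err * t := by
    calc I * t = ∫⁻ _s in Ioc (0 : ℝ) t, I := by rw [setLIntegral_const, hvol]
      _ ≤ ∫⁻ s in Ioc (0 : ℝ) t, ((∫⁻ ω, ∫⁻ x,
          ‖h x‖ₑ * interaction v (worldLine x ω s.toNNReal) * ‖h (worldLine x ω t)‖ₑ
            ∂volume ∂wienerPaths N) + err) := by
          refine setLIntegral_mono' measurableSet_Ioc fun s hs' => ?_
          exact (hslice s.toNNReal (Real.toNNReal_le_iff_le_coe.2 hs'.2)).2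
      _ = _ := by rw [lintegral_add_right _ measurable_const, setLIntegral_const, hvol]
  constructor
  · rw [tsub_le_iff_right]
    calc I = I * t / t := (ENNReal.mul_div_cancel_right ht0 httop).symm
      _ ≤ ((∫⁻ s in Ioc (0 : ℝ) t, ∫⁻ ω, ∫⁻ x,
            ‖h x‖ₑ * interaction v (worldLine x ω s.toNNReal) * ‖h (worldLine x ω t)‖ₑ
              ∂volume ∂wienerPaths N) + err * t) / t := by gcongr
      _ = (∫⁻ s in Ioc (0 : ℝ) t, ∫⁻ ω, ∫⁻ x,
            ‖h x‖ₑ * interaction v (worldLine x ω s.toNNReal) * ‖h (worldLine x ω t)‖ₑ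
              ∂volume ∂wienerPaths N) / t + err := by
          rw [ENNReal.add_div, ENNReal.mul_div_cancel_right ht0 httop]
      _ ≤ _ + ε := by gcongr
  · calc (∫⁻ s in Ioc (0 : ℝ) t, ∫⁻ ω, ∫⁻ x,
          ‖h x‖ₑ * interaction v (worldLine x ω s.toNNReal) * ‖h (worldLine x ω t)‖ₑ
            ∂volume ∂wienerPaths N) / t ≤ (I + err) * t / t := by gcongr
      _ = I + err := ENNReal.mul_div_cancel_right ht0 httop
      _ ≤ I + ε := by gcongr

end Interaction

end Literature.MathematicalPhysics.QuantumManyBody.BoseGas
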